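import Summits.QuantumFields.BalabanUV.T4Continuum.Support.SkeletonFillFullSmall
import Summits.QuantumFields.BalabanUV.T4Continuum.Support.SkeletonFillFullRootFar

/-!
# T⁴ programme, node NE3 — leaf R1c∕R1d (row NE3-S4d): ROOT-CLOSENESS OF THE FILLING'S PLAQUETTES, case IV (F4d)

Cell `pub-balaban`, NE3 formalisation swarm, unit `b2b-balaban-t4-ne3-formalise-leaf-04` (gen 2), for row **S4d** of
`t4/formal/NE3/LEAVES.md` BY ARRANGEMENT with its holder leaf-07 (journal «F3-GRAD PLAN v1», 2026-08-20).  Hypothesis `hroot` of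
`SkeletonFillFullGradReduce.covGrad_fullFill_le_of_rootClose` (F4a), case IV: the FAR-CORNER plaquette (`μ < ν`, `q_μ = q_ν = L−1`)
of `fullFill L T h` is within `ρ_IV = 2d(L−1)(1+L)δ + 2(θ+θ_L)² + 2(L−1)a₀(θ+θ_L) + 2(L−1)La₀(θ+2θ_L) + 2(2θ+3θ_L)a₀` of its
cell's root (`θ = d(L−1)a₀`, `θ_L = d(L−1)La₀`; `δ` = covariant root gradient across `(z,μ)`, `(z,ν)`; root identity
`h^{L²} = T(∂p)`).  Word = leaf-07's `hol_plaq_fullFill_corner` (F2) BY NAME; chain = leaf-07's `norm_plaq_corner_sub_one_le`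
(F3c) VERBATIM up to its last step, re-targeted from `Y` to `g·Y`: both sides reduce to `Z = B·(Λ_aΛ_b)·(A₁A₂Λ_μ)·g^{(L−1)L}`
and the anchor costs one commutator `‖Zg − gZ‖ ≤ 2‖Z−1‖‖g−1‖` — NO term linear in `a₀`.  [folklore], 0 sorry.
HONEST FRAMING.  Kinematic norm bookkeeping; no minimiser, no `BetaPertH`∕(B)∕G-an2-4; nothing on infinite volume, mass gap
or Clay; **NE3 is NOT proved**; `ApproxRefine` NOT proved.  Finite T⁴ rung (B)+1.  ABSOLUTE RULE kept: no printed sentence is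
a hypothesis; no `def … : Prop` fact; axioms ⊆ {propext, Classical.choice, Quot.sound}.  PLACEMENT `Summits/QuantumFields/
BalabanUV/`; imports leaf-07's F3c + F4c.  HONEST DEPENDENCY: continuum YM on T⁴ ⇐ BetaPertH ∧ nine spine estimates (0/9
proved); BetaPertH ⇐ (D1) ∧ (D4) ∧ CAP+tail; G-an2-4 gates asym, D1 and NE2/3/4.
-/

set_option autoImplicit false
open scoped BigOperators Matrix Matrix.Norms.L2Operator
open NormedSpace

namespace Summit.QuantumFields.BalabanUV.T4Continuum.SkeletonFillFullRootCorner

open Literature.MathematicalPhysics.QuantumFieldTheory.Balaban1983to89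
open B7Prop1Explicit B7Prop2Explicit B7Prop1Local MatrixLog UnitaryModel
open T4AveragingDeficitWall hiding Site Plane Plaq Bond
open AveragingDeficitTransport AveragingDeficitNearIdentity GaugeFieldPerturbation
open SkeletonLattice SkeletonFill SkeletonFillFull SkeletonFillFullNorms SkeletonFillFullFaces
open SkeletonFillFullSmall (pow_corner_tally two_mul_mul_le)
open SkeletonFillFullRootFar (norm_val_plaq4_sub_eq)

noncomputable section
variable {d : ℕ} {n : Type*} [Fintype n] [DecidableEq n]

section CaseIV

variable [Nonempty n] {L : ℕ} {a₀ δ : ℝ}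

set_option maxHeartbeats 400000 in
/-- **CASE IV (THE FAR CORNER) AGAINST ITS ROOT** (`μ < ν`, `q_μ = q_ν = L − 1`): `‖W(∂p) − h(z;μ,ν)‖ ≤ ρ_IV` (module
docstring); one long bookkeeping proof, heartbeat budget doubled. [folklore] -/
theorem norm_plaq_corner_sub_root_le (hL : 1 ≤ L) {T : Site d → Fin d → (Matrix n n ℂ)ˣ}
    {h : Site d → Fin d → Fin d → (Matrix n n ℂ)ˣ}
    (hT : ∀ (z : Site d) (κ : Fin d), T z κ ∈ unitaryUnits (Matrix n n ℂ))
    (hh : ∀ (z : Site d) (κ ν : Fin d), h z κ ν ∈ unitaryUnits (Matrix n n ℂ))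
    (ha : ∀ (z : Site d) (κ ν : Fin d), κ < ν → ‖((h z κ ν : (Matrix n n ℂ)ˣ) : Matrix n n ℂ) - 1‖ ≤ a₀) (ha0 : 0 ≤ a₀)
    {z : Site d}
    (hδ : ∀ ρ κ ι : Fin d, κ < ι →
      ‖((T z ρ * h (z + e ρ) κ ι * (T z ρ)⁻¹ : (Matrix n n ℂ)ˣ) : Matrix n n ℂ) - ((h z κ ι : (Matrix n n ℂ)ˣ) : Matrix n n ℂ)‖
        ≤ δ) (hδ0 : 0 ≤ δ)
    {q : Site d} (hq : InBox L q) {μ ν : Fin d} (hμν : μ < ν)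
    (hroot : (h z μ ν) ^ (L * L) = hol T z (plaqWord μ ν))
    (hμ : q μ = (L : ℤ) - 1) (hν : q ν = (L : ℤ) - 1) :
    ‖((hol (fullFill L T h) ((L : ℤ) • z + q) (plaqWord μ ν) : (Matrix n n ℂ)ˣ) : Matrix n n ℂ)
        - ((h z μ ν : (Matrix n n ℂ)ˣ) : Matrix n n ℂ)‖
      ≤ (2 * (d * ((L - 1 : ℕ) * δ)) + 2 * (d * (((L - 1 : ℕ) * L) * δ)))
        + (2 * (d * ((L - 1 : ℕ) * a₀) + d * (((L - 1 : ℕ) * L) * a₀)) * (d * ((L - 1 : ℕ) * a₀) + d * (((L - 1 : ℕ) * L) * a₀))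
          + 2 * ((L - 1 : ℕ) * a₀) * (d * ((L - 1 : ℕ) * a₀) + d * (((L - 1 : ℕ) * L) * a₀))
          + 2 * (2 * (d * ((L - 1 : ℕ) * a₀)) + 3 * (d * (((L - 1 : ℕ) * L) * a₀))) * a₀
          + 2 * (((L - 1 : ℕ) * L) * a₀) * (d * ((L - 1 : ℕ) * a₀) + 2 * (d * (((L - 1 : ℕ) * L) * a₀)))) := by
  -- unitarity bookkeeping
  have hF : ∀ (z' q' : Site d) (κ i : Fin d), ((h z' κ i) ^ (q' i).toNat)⁻¹ ∈ unitaryUnits (Matrix n n ℂ) :=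
    fun _ _ _ _ => (unitaryUnits _).inv_mem ((unitaryUnits _).pow_mem (hh _ _ _) _)
  have hGm : ∀ (z' q' : Site d) (i κ : Fin d), (h z' i κ) ^ ((q' i).toNat * L) ∈ unitaryUnits (Matrix n n ℂ) :=
    fun _ _ _ _ => (unitaryUnits _).pow_mem (hh _ _ _) _
  have huA : ∀ (z' q' : Site d) (κ : Fin d), hiProd h z' q' κ ∈ unitaryUnits (Matrix n n ℂ) := fun _ _ _ =>
    prodOver_mem fun i _ => hF _ _ _ _
  have huL : ∀ (z' q' : Site d) (κ : Fin d), loProd L h z' q' κ ∈ unitaryUnits (Matrix n n ℂ) := fun _ _ _ =>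
    prodOver_mem fun i _ => hGm _ _ _ _
  have hconj : ∀ {t x : (Matrix n n ℂ)ˣ}, t ∈ unitaryUnits (Matrix n n ℂ) → x ∈ unitaryUnits (Matrix n n ℂ) →
      t * x * t⁻¹ ∈ unitaryUnits (Matrix n n ℂ) := fun ht hx =>
    (unitaryUnits _).mul_mem ((unitaryUnits _).mul_mem ht hx) ((unitaryUnits _).inv_mem ht)
  -- names (block `z` frame)
  set A := hiProd h z q μ with hAdef
  set B := hiProd h z q ν with hBdef
  set Λμ := loProd L h z q μ with hΛμdef
  set Λν := loProd L h z q ν with hΛνdef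
  set tμ := T z μ with htμdef
  set tν := T z ν with htνdef
  set Bs := hiProd h (z + e μ) q ν with hBsdef
  set Λs := loProd L h (z + e μ) (q + e μ - (L : ℤ) • e μ) ν with hΛsdef
  set tν' := T (z + e μ) ν with htν'def
  set As := hiProd h (z + e ν) (q + e ν - (L : ℤ) • e ν) μ with hAsdef
  set Λh := loProd L h (z + e ν) q μ with hΛhdef
  set tμ' := T (z + e ν) μ with htμ'def
  set g := h z μ ν with hgdef
  have hgu : g ∈ unitaryUnits (Matrix n n ℂ) := hh _ _ _
  have hugk : ∀ k : ℕ, g ^ k ∈ unitaryUnits (Matrix n n ℂ) := fun k => (unitaryUnits _).pow_mem hgu k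
  -- the chain plaquette: `tμ tν' = g^{L²} tν tμ'`
  have hΘ : tμ * tν' = g ^ (L * L) * (tν * tμ') := by
    rw [hgdef, hroot, hol_plaqWord_eq, htμdef, htν'def, htνdef, htμ'def]; group
  -- the word and its transport to the frame of `z`
  have hword : hiProd h z q μ * (loProd L h z q μ * T z μ)
        * (hiProd h (z + e μ) q ν * (loProd L h (z + e μ) (q + e μ - (L : ℤ) • e μ) ν * T (z + e μ) ν))
        * (hiProd h (z + e ν) (q + e ν - (L : ℤ) • e ν) μ * (loProd L h (z + e ν) q μ * T (z + e ν) μ))⁻¹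
        * (hiProd h z q ν * (loProd L h z q ν * T z ν))⁻¹
      = (A * Λμ * tμ) * (Bs * Λs * tν') * (As * Λh * tμ')⁻¹ * (B * Λν * tν)⁻¹ := by
    simp only [hAdef, hBdef, hΛμdef, hΛνdef, htμdef, htνdef, hBsdef, hΛsdef, htν'def, hAsdef, hΛhdef, htμ'def]; group
  have eX : (A * Λμ * tμ) * (Bs * Λs * tν')
      = A * Λμ * (tμ * Bs * tμ⁻¹) * (tμ * Λs * tμ⁻¹) * g ^ (L * L) * (tν * tμ') := by
    rw [show (A * Λμ * tμ) * (Bs * Λs * tν') = A * Λμ * (tμ * Bs * tμ⁻¹) * (tμ * Λs * tμ⁻¹) * (tμ * tν') by group, hΘ]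
    group
  have eY : (B * Λν * tν) * (As * Λh * tμ') = B * Λν * (tν * As * tν⁻¹) * (tν * Λh * tν⁻¹) * (tν * tμ') := by group
  have huN : B * Λν * tν ∈ unitaryUnits (Matrix n n ℂ) := (unitaryUnits _).mul_mem ((unitaryUnits _).mul_mem (huA _ _ _) (huL _ _ _)) (hT _ _)
  have huA'' : As * Λh * tμ' ∈ unitaryUnits (Matrix n n ℂ) := (unitaryUnits _).mul_mem ((unitaryUnits _).mul_mem (huA _ _ _) (huL _ _ _)) (hT _ _)
  rw [hol_plaq_fullFill_corner hL hq hμν hμ hν, hword, norm_val_plaq4_sub_eq huA'' huN, eX, eY,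
    show (g * (B * Λν * (tν * As * tν⁻¹) * (tν * Λh * tν⁻¹) * (tν * tμ')) : (Matrix n n ℂ)ˣ)
      = (g * (B * Λν * (tν * As * tν⁻¹) * (tν * Λh * tν⁻¹))) * (tν * tμ') by group,
    norm_val_mul_right_sub ((unitaryUnits _).mul_mem (hT _ _) (hT _ _))]
  -- splits: `A` at `ν` (μ < ν), `Λν` at `μ`, and the neighbours' products
  obtain ⟨l₁, l₂, hν₁, hν₂, hl₁₂, hlen, hHsplit⟩ := hiProd_split (G := (Matrix n n ℂ)ˣ) h hμν
  obtain ⟨m₁, m₂, hμ₁, hμ₂, hm₁₂, hmlen, hLsplit⟩ := loProd_split (G := (Matrix n n ℂ)ˣ) L h hμν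
  set F : Fin d → (Matrix n n ℂ)ˣ := fun i => ((h z μ i) ^ (q i).toNat)⁻¹ with hFdef
  set A₁ := prodOver l₁ F with hA₁def
  set A₂ := prodOver l₂ F with hA₂def
  have hA : A = A₁ * (g ^ (q ν).toNat)⁻¹ * A₂ := hHsplit z q
  set Gf : Fin d → (Matrix n n ℂ)ˣ := fun i => (h z i ν) ^ ((q i).toNat * L) with hGfdef
  set Λa := prodOver m₁ Gf with hΛadef
  set Λb := prodOver m₂ Gf with hΛbdef
  have hΛν : Λν = Λa * g ^ ((q μ).toNat * L) * Λb := hLsplit z q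
  -- `Ã := tν As tν⁻¹ = Ã₁ Ã₂`
  set F' : Fin d → (Matrix n n ℂ)ˣ := fun i => ((h (z + e ν) μ i) ^ ((q + e ν - (L : ℤ) • e ν) i).toNat)⁻¹ with hF'def
  have hmid : ((h (z + e ν) μ ν) ^ ((q + e ν - (L : ℤ) • e ν) ν).toNat)⁻¹ = 1 := by
    simp only [Pi.add_apply, Pi.sub_apply, Pi.smul_apply, e_apply, if_true, smul_eq_mul, mul_one, hν]; norm_num
  have hF'off : ∀ i, i ≠ ν → F' i = ((h (z + e ν) μ i) ^ (q i).toNat)⁻¹ := fun i hi => by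
    simp only [hF'def, Pi.add_apply, Pi.sub_apply, Pi.smul_apply, e_apply, if_neg hi, smul_eq_mul, mul_zero,
      add_zero, sub_zero]
  have hAs : As = prodOver l₁ F' * prodOver l₂ F' := by
    rw [hAsdef, hHsplit (z + e ν) (q + e ν - (L : ℤ) • e ν), hmid, mul_one]
  set At₁ := tν * prodOver l₁ F' * tν⁻¹ with hAt₁def
  set At₂ := tν * prodOver l₂ F' * tν⁻¹ with hAt₂def
  have hAt : tν * As * tν⁻¹ = At₁ * At₂ := by rw [hAs, hAt₁def, hAt₂def]; group
  -- `Λ̃♯ := tμ Λs tμ⁻¹ = Λt_a Λt_b` (its `μ`-slot has exponent `0`)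
  set G' : Fin d → (Matrix n n ℂ)ˣ := fun i => (h (z + e μ) i ν) ^ (((q + e μ - (L : ℤ) • e μ) i).toNat * L) with hG'def
  have hmid' : (h (z + e μ) μ ν) ^ (((q + e μ - (L : ℤ) • e μ) μ).toNat * L) = 1 := by
    simp only [Pi.add_apply, Pi.sub_apply, Pi.smul_apply, e_apply, if_true, smul_eq_mul, mul_one, hμ]; norm_num
  have hG'off : ∀ i, i ≠ μ → G' i = (h (z + e μ) i ν) ^ ((q i).toNat * L) := fun i hi => by
    simp only [hG'def, Pi.add_apply, Pi.sub_apply, Pi.smul_apply, e_apply, if_neg hi, smul_eq_mul, mul_zero,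
      add_zero, sub_zero]
  have hΛs : Λs = prodOver m₁ G' * prodOver m₂ G' := by
    rw [hΛsdef, hLsplit (z + e μ) (q + e μ - (L : ℤ) • e μ), hmid', mul_one]
  set Λt₁ := tμ * prodOver m₁ G' * tμ⁻¹ with hΛt₁def
  set Λt₂ := tμ * prodOver m₂ G' * tμ⁻¹ with hΛt₂def
  have hΛt : tμ * Λs * tμ⁻¹ = Λt₁ * Λt₂ := by rw [hΛs, hΛt₁def, hΛt₂def]; group
  -- unitarity of the pieces
  have huF : ∀ i, F i ∈ unitaryUnits (Matrix n n ℂ) := fun i => hF _ _ _ _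
  have huF' : ∀ i, F' i ∈ unitaryUnits (Matrix n n ℂ) := fun i => hF _ _ _ _
  have huGf : ∀ i, Gf i ∈ unitaryUnits (Matrix n n ℂ) := fun i => hGm _ _ _ _
  have huG' : ∀ i, G' i ∈ unitaryUnits (Matrix n n ℂ) := fun i => hGm _ _ _ _
  have huA₁ : A₁ ∈ unitaryUnits (Matrix n n ℂ) := prodOver_mem fun i _ => huF i
  have huA₂ : A₂ ∈ unitaryUnits (Matrix n n ℂ) := prodOver_mem fun i _ => huF i
  have huΛa : Λa ∈ unitaryUnits (Matrix n n ℂ) := prodOver_mem fun i _ => huGf i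
  have huΛb : Λb ∈ unitaryUnits (Matrix n n ℂ) := prodOver_mem fun i _ => huGf i
  have huAt₁ : At₁ ∈ unitaryUnits (Matrix n n ℂ) := hconj (hT _ _) (prodOver_mem fun i _ => huF' i)
  have huAt₂ : At₂ ∈ unitaryUnits (Matrix n n ℂ) := hconj (hT _ _) (prodOver_mem fun i _ => huF' i)
  have huΛt₁ : Λt₁ ∈ unitaryUnits (Matrix n n ℂ) := hconj (hT _ _) (prodOver_mem fun i _ => huG' i)
  have huΛt₂ : Λt₂ ∈ unitaryUnits (Matrix n n ℂ) := hconj (hT _ _) (prodOver_mem fun i _ => huG' i)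
  have huBt : tμ * Bs * tμ⁻¹ ∈ unitaryUnits (Matrix n n ℂ) := hconj (hT _ _) (huA _ _ _)
  have huΛht : tν * Λh * tν⁻¹ ∈ unitaryUnits (Matrix n n ℂ) := hconj (hT _ _) (huL _ _ _)
  -- sizes
  set θ : ℝ := d * ((L - 1 : ℕ) * a₀) with hθdef
  set θL : ℝ := d * (((L - 1 : ℕ) * L) * a₀) with hθLdef
  have hθ0 : 0 ≤ θ := by positivity
  have hθL0 : 0 ≤ θL := by positivity
  have hθA : ‖(A : Matrix n n ℂ) - 1‖ ≤ θ := norm_hiProd_sub_one_le hh ha ha0 z hq μ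
  have hθB : ‖(B : Matrix n n ℂ) - 1‖ ≤ θ := norm_hiProd_sub_one_le hh ha ha0 z hq ν
  have hθΛμ : ‖(Λμ : Matrix n n ℂ) - 1‖ ≤ θL := norm_loProd_sub_one_le hh ha ha0 z hq μ
  have hfac : ∀ i, μ < i → ‖(F i : Matrix n n ℂ) - 1‖ ≤ (L - 1 : ℕ) * a₀ := fun i hi => by
    rw [hFdef]; dsimp only
    rw [norm_val_inv_sub_one ((unitaryUnits _).pow_mem (hh _ _ _) _)]
    refine (norm_val_pow_sub_one_le (hh _ _ _) _).trans ?_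
    exact mul_le_mul (by exact_mod_cast toNat_le_of_inBox hq i) (ha _ _ _ hi) (norm_nonneg _) (by positivity)
  have hgfac : ∀ i, i < ν → ‖(Gf i : Matrix n n ℂ) - 1‖ ≤ ((L - 1 : ℕ) * L) * a₀ := fun i hi => by
    rw [hGfdef]; dsimp only
    refine (norm_val_pow_sub_one_le (hh _ _ _) _).trans ?_
    push_cast
    exact mul_le_mul (by exact_mod_cast Nat.mul_le_mul_right L (toNat_le_of_inBox hq i)) (ha _ _ _ hi)
      (norm_nonneg _) (by positivity)
  have hl₁₂d : (l₁.length : ℝ) + l₂.length ≤ d := by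
    have := length_above_le μ; exact_mod_cast (by omega : l₁.length + l₂.length ≤ d)
  have hm₁₂d : (m₁.length : ℝ) + m₂.length ≤ d := by
    have := length_below_le ν; exact_mod_cast (by omega : m₁.length + m₂.length ≤ d)
  have hθA₁A₂ : ‖((A₁ * A₂ : (Matrix n n ℂ)ˣ) : Matrix n n ℂ) - 1‖ ≤ θ := by
    rw [Units.val_mul]
    refine (B8Ineq170.norm_mul_sub_one_le_of_norm_le_one (norm_val_of_unitary huA₁).le).trans ?_
    refine (add_le_add (norm_val_prodOver_sub_one_le (fun i _ => huF i) fun i hi => hfac i (hl₁₂ i (List.mem_append_left _ hi)))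
      (norm_val_prodOver_sub_one_le (fun i _ => huF i) fun i hi => hfac i (hl₁₂ i (List.mem_append_right _ hi)))).trans ?_
    rw [← add_mul, hθdef]; exact mul_le_mul_of_nonneg_right hl₁₂d (by positivity)
  have hθΛaΛb : ‖((Λa * Λb : (Matrix n n ℂ)ˣ) : Matrix n n ℂ) - 1‖ ≤ θL := by
    rw [Units.val_mul]
    refine (B8Ineq170.norm_mul_sub_one_le_of_norm_le_one (norm_val_of_unitary huΛa).le).trans ?_
    refine (add_le_add (norm_val_prodOver_sub_one_le (fun i _ => huGf i) fun i hi => hgfac i (hm₁₂ i (List.mem_append_left _ hi)))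
      (norm_val_prodOver_sub_one_le (fun i _ => huGf i) fun i hi => hgfac i (hm₁₂ i (List.mem_append_right _ hi)))).trans ?_
    rw [← add_mul, hθLdef]; exact mul_le_mul_of_nonneg_right hm₁₂d (by positivity)
  have hθΛb : ‖(Λb : Matrix n n ℂ) - 1‖ ≤ θL := by
    refine (norm_val_prodOver_sub_one_le (fun i _ => huGf i)
      fun i hi => hgfac i (hm₁₂ i (List.mem_append_right _ hi))).trans ?_
    rw [hθLdef]
    exact mul_le_mul_of_nonneg_right (by linarith [show (0 : ℝ) ≤ m₁.length from by positivity]) (by positivity)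
  have hgm1 : ‖((g ^ (q ν).toNat : (Matrix n n ℂ)ˣ) : Matrix n n ℂ) - 1‖ ≤ (L - 1 : ℕ) * a₀ := (norm_val_pow_sub_one_le hgu _).trans
      (mul_le_mul (by exact_mod_cast toNat_le_of_inBox hq ν) (ha _ _ _ hμν) (norm_nonneg _) (by positivity))
  have hgkL : ‖((g ^ ((q μ).toNat * L) : (Matrix n n ℂ)ˣ) : Matrix n n ℂ) - 1‖ ≤ ((L - 1 : ℕ) * L) * a₀ := by
    refine (norm_val_pow_sub_one_le hgu _).trans ?_
    push_cast
    exact mul_le_mul (by exact_mod_cast Nat.mul_le_mul_right L (toNat_le_of_inBox hq μ)) (ha _ _ _ hμν)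
      (norm_nonneg _) (by positivity)
  -- the transported pieces are `δ`-close
  have hδB : ‖((tμ * Bs * tμ⁻¹ : (Matrix n n ℂ)ˣ) : Matrix n n ℂ) - (B : Matrix n n ℂ)‖ ≤ d * ((L - 1 : ℕ) * δ) :=
    norm_conj_hiProd_sub_le hh (hT _ _) (fun κ ι hκι => hδ μ κ ι hκι) hδ0 hq ν
  have hδA : ‖((At₁ * At₂ : (Matrix n n ℂ)ˣ) : Matrix n n ℂ) - ((A₁ * A₂ : (Matrix n n ℂ)ˣ) : Matrix n n ℂ)‖
      ≤ d * ((L - 1 : ℕ) * δ) := by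
    rw [Units.val_mul, Units.val_mul]
    refine (norm_mul_sub_mul_le_of_norm_le_one (norm_val_of_unitary huAt₂).le (norm_val_of_unitary huA₁).le).trans ?_
    have h1 : ‖(At₁ : Matrix n n ℂ) - (A₁ : Matrix n n ℂ)‖ ≤ l₁.length * ((L - 1 : ℕ) * δ) := by
      rw [hAt₁def, hA₁def, prodOver_congr (fun i hi => hF'off i (fun he => hν₁ (he ▸ hi)))]
      exact norm_conj_prodOver_powInv_sub_le (k := fun i => (q i).toNat) (fun i => hh z μ i)
        (fun i => hh (z + e ν) μ i) (hT _ _) (fun i hi => hδ ν μ i (hl₁₂ i (List.mem_append_left _ hi)))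
        (fun i _ => toNat_le_of_inBox hq i)
    have h2 : ‖(At₂ : Matrix n n ℂ) - (A₂ : Matrix n n ℂ)‖ ≤ l₂.length * ((L - 1 : ℕ) * δ) := by
      rw [hAt₂def, hA₂def, prodOver_congr (fun i hi => hF'off i (fun he => hν₂ (he ▸ hi)))]
      exact norm_conj_prodOver_powInv_sub_le (k := fun i => (q i).toNat) (fun i => hh z μ i)
        (fun i => hh (z + e ν) μ i) (hT _ _) (fun i hi => hδ ν μ i (hl₁₂ i (List.mem_append_right _ hi)))
        (fun i _ => toNat_le_of_inBox hq i)
    refine (add_le_add h1 h2).trans ?_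
    rw [← add_mul]; exact mul_le_mul_of_nonneg_right hl₁₂d (by positivity)
  have hδΛs : ‖((Λt₁ * Λt₂ : (Matrix n n ℂ)ˣ) : Matrix n n ℂ) - ((Λa * Λb : (Matrix n n ℂ)ˣ) : Matrix n n ℂ)‖
      ≤ d * (((L - 1 : ℕ) * L) * δ) := by
    rw [Units.val_mul, Units.val_mul]
    refine (norm_mul_sub_mul_le_of_norm_le_one (norm_val_of_unitary huΛt₂).le (norm_val_of_unitary huΛa).le).trans ?_
    have h1 : ‖(Λt₁ : Matrix n n ℂ) - (Λa : Matrix n n ℂ)‖ ≤ m₁.length * (((L - 1 : ℕ) * L : ℕ) * δ) := by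
      rw [hΛt₁def, hΛadef, prodOver_congr (fun i hi => hG'off i (fun he => hμ₁ (he ▸ hi)))]
      exact norm_conj_prodOver_pow_sub_le (k := fun i => (q i).toNat * L) (fun i => hh z i ν)
        (fun i => hh (z + e μ) i ν) (hT _ _) (fun i hi => hδ μ i ν (hm₁₂ i (List.mem_append_left _ hi)))
        (fun i _ => Nat.mul_le_mul_right L (toNat_le_of_inBox hq i))
    have h2 : ‖(Λt₂ : Matrix n n ℂ) - (Λb : Matrix n n ℂ)‖ ≤ m₂.length * (((L - 1 : ℕ) * L : ℕ) * δ) := by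
      rw [hΛt₂def, hΛbdef, prodOver_congr (fun i hi => hG'off i (fun he => hμ₂ (he ▸ hi)))]
      exact norm_conj_prodOver_pow_sub_le (k := fun i => (q i).toNat * L) (fun i => hh z i ν)
        (fun i => hh (z + e μ) i ν) (hT _ _) (fun i hi => hδ μ i ν (hm₁₂ i (List.mem_append_right _ hi)))
        (fun i _ => Nat.mul_le_mul_right L (toNat_le_of_inBox hq i))
    refine (add_le_add h1 h2).trans ?_
    push_cast
    rw [← add_mul]; exact mul_le_mul_of_nonneg_right hm₁₂d (by positivity)
  have hδΛh : ‖((tν * Λh * tν⁻¹ : (Matrix n n ℂ)ˣ) : Matrix n n ℂ) - (Λμ : Matrix n n ℂ)‖ ≤ d * (((L - 1 : ℕ) * L) * δ) := by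
    have hlen' : ((below μ).length : ℝ) ≤ d := by exact_mod_cast length_below_le μ
    rw [hΛhdef, hΛμdef]
    unfold loProd
    refine (norm_conj_prodOver_pow_sub_le (k := fun i => (q i).toNat * L) (K := (L - 1) * L) (fun i => hh z i μ)
      (fun i => hh (z + e ν) i μ) (hT _ _) (fun i hi => hδ ν i μ (mem_below.mp hi))
      (fun i _ => Nat.mul_le_mul_right L (toNat_le_of_inBox hq i))).trans ?_
    push_cast
    exact mul_le_mul_of_nonneg_right hlen' (by positivity)
  -- STEP A: replace the transported pieces (`X → X'`, `Y → Y'`)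
  have stepA1 : ‖((A * Λμ * (tμ * Bs * tμ⁻¹) * (tμ * Λs * tμ⁻¹) * g ^ (L * L) : (Matrix n n ℂ)ˣ) : Matrix n n ℂ)
      - ((A * Λμ * B * (Λa * Λb) * g ^ (L * L) : (Matrix n n ℂ)ˣ) : Matrix n n ℂ)‖
      ≤ d * ((L - 1 : ℕ) * δ) + d * (((L - 1 : ℕ) * L) * δ) := by
    rw [hΛt, show (A * Λμ * (tμ * Bs * tμ⁻¹) * (Λt₁ * Λt₂) * g ^ (L * L) : (Matrix n n ℂ)ˣ)
        = (A * Λμ) * ((tμ * Bs * tμ⁻¹) * (Λt₁ * Λt₂)) * g ^ (L * L) by group,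
      show (A * Λμ * B * (Λa * Λb) * g ^ (L * L) : (Matrix n n ℂ)ˣ) = (A * Λμ) * (B * (Λa * Λb)) * g ^ (L * L) by group,
      norm_val_frame_sub ((unitaryUnits _).mul_mem (huA _ _ _) (huL _ _ _)) (hugk _), Units.val_mul, Units.val_mul]
    exact (norm_mul_sub_mul_le_of_norm_le_one (norm_val_of_unitary ((unitaryUnits _).mul_mem huΛt₁ huΛt₂)).le (norm_val_of_unitary (huA _ _ _)).le).trans (add_le_add hδB hδΛs)
  have stepA2 : ‖((B * Λν * (At₁ * At₂) * (tν * Λh * tν⁻¹) : (Matrix n n ℂ)ˣ) : Matrix n n ℂ)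
      - ((B * Λν * (A₁ * A₂) * Λμ : (Matrix n n ℂ)ˣ) : Matrix n n ℂ)‖
      ≤ d * ((L - 1 : ℕ) * δ) + d * (((L - 1 : ℕ) * L) * δ) := by
    rw [show (B * Λν * (At₁ * At₂) * (tν * Λh * tν⁻¹) : (Matrix n n ℂ)ˣ) = (B * Λν) * ((At₁ * At₂) * (tν * Λh * tν⁻¹)) * 1
        by group,
      show (B * Λν * (A₁ * A₂) * Λμ : (Matrix n n ℂ)ˣ) = (B * Λν) * ((A₁ * A₂) * Λμ) * 1 by group,
      norm_val_frame_sub ((unitaryUnits _).mul_mem (huA _ _ _) (huL _ _ _)) (unitaryUnits _).one_mem,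
      Units.val_mul, Units.val_mul]
    exact (norm_mul_sub_mul_le_of_norm_le_one (norm_val_of_unitary huΛht).le (norm_val_of_unitary ((unitaryUnits _).mul_mem huA₁ huA₂)).le).trans (add_le_add hδA hδΛh)
  -- STEP B: reorder `X' = (A Λμ)(B ΛaΛb) g^{L²}` → `(B ΛaΛb)(A Λμ) g^{L²}` → `(B ΛaΛb)(A₁A₂Λμ)(g^m)⁻¹ g^{L²}`
  have hAΛμ : ‖((A * Λμ : (Matrix n n ℂ)ˣ) : Matrix n n ℂ) - 1‖ ≤ θ + θL := by
    rw [Units.val_mul]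
    exact (B8Ineq170.norm_mul_sub_one_le_of_norm_le_one (norm_val_of_unitary (huA _ _ _)).le).trans (add_le_add hθA hθΛμ)
  have hBΛab : ‖((B * (Λa * Λb) : (Matrix n n ℂ)ˣ) : Matrix n n ℂ) - 1‖ ≤ θ + θL := by
    rw [Units.val_mul]
    exact (B8Ineq170.norm_mul_sub_one_le_of_norm_le_one (norm_val_of_unitary (huA _ _ _)).le).trans
      (add_le_add hθB hθΛaΛb)
  have hA₂Λμ : ‖((A₂ * Λμ : (Matrix n n ℂ)ˣ) : Matrix n n ℂ) - 1‖ ≤ θ + θL := by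
    rw [Units.val_mul]
    refine (B8Ineq170.norm_mul_sub_one_le_of_norm_le_one (norm_val_of_unitary huA₂).le).trans (add_le_add ?_ hθΛμ)
    refine (norm_val_prodOver_sub_one_le (fun i _ => huF i)
      fun i hi => hfac i (hl₁₂ i (List.mem_append_right _ hi))).trans ?_
    rw [hθdef]
    exact mul_le_mul_of_nonneg_right (by linarith [show (0 : ℝ) ≤ l₁.length from by positivity]) (by positivity)
  have stepB1 : ‖((A * Λμ * B * (Λa * Λb) * g ^ (L * L) : (Matrix n n ℂ)ˣ) : Matrix n n ℂ)
      - ((B * (Λa * Λb) * (A * Λμ) * g ^ (L * L) : (Matrix n n ℂ)ˣ) : Matrix n n ℂ)‖ ≤ 2 * (θ + θL) * (θ + θL) := by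
    rw [show (A * Λμ * B * (Λa * Λb) * g ^ (L * L) : (Matrix n n ℂ)ˣ) = 1 * ((A * Λμ) * (B * (Λa * Λb))) * g ^ (L * L)
        by group,
      show (B * (Λa * Λb) * (A * Λμ) * g ^ (L * L) : (Matrix n n ℂ)ˣ) = 1 * ((B * (Λa * Λb)) * (A * Λμ)) * g ^ (L * L)
        by group]
    refine (norm_val_swap_le (unitaryUnits _).one_mem (hugk _) _ _).trans ?_
    exact two_mul_mul_le (mul_le_mul hAΛμ hBΛab (norm_nonneg _) (by linarith))
  have stepB2 : ‖((B * (Λa * Λb) * (A * Λμ) * g ^ (L * L) : (Matrix n n ℂ)ˣ) : Matrix n n ℂ)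
      - ((B * (Λa * Λb) * (A₁ * A₂ * Λμ) * ((g ^ (q ν).toNat)⁻¹ * g ^ (L * L)) : (Matrix n n ℂ)ˣ) : Matrix n n ℂ)‖
      ≤ 2 * ((L - 1 : ℕ) * a₀) * (θ + θL) := by
    rw [hA, show (B * (Λa * Λb) * (A₁ * (g ^ (q ν).toNat)⁻¹ * A₂ * Λμ) * g ^ (L * L) : (Matrix n n ℂ)ˣ)
        = (B * (Λa * Λb) * A₁) * ((g ^ (q ν).toNat)⁻¹ * (A₂ * Λμ)) * g ^ (L * L) by group,
      show (B * (Λa * Λb) * (A₁ * A₂ * Λμ) * ((g ^ (q ν).toNat)⁻¹ * g ^ (L * L)) : (Matrix n n ℂ)ˣ)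
        = (B * (Λa * Λb) * A₁) * ((A₂ * Λμ) * (g ^ (q ν).toNat)⁻¹) * g ^ (L * L) by group]
    refine (norm_val_swap_le ((unitaryUnits _).mul_mem ((unitaryUnits _).mul_mem (huA _ _ _) ((unitaryUnits _).mul_mem huΛa huΛb)) huA₁) (hugk _) _ _).trans ?_
    rw [norm_val_inv_sub_one (hugk _)]
    exact two_mul_mul_le (mul_le_mul hgm1 hA₂Λμ (norm_nonneg _) (by positivity))
  -- STEP C: reorder `Y' = B Λa g^{kL} Λb (A₁A₂) Λμ` → `(B ΛaΛb)(A₁A₂Λμ) g^{kL}`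
  have hΛbAΛ : ‖((Λb * (A₁ * A₂ * Λμ) : (Matrix n n ℂ)ˣ) : Matrix n n ℂ) - 1‖ ≤ θL + (θ + θL) := by
    rw [Units.val_mul]
    refine (B8Ineq170.norm_mul_sub_one_le_of_norm_le_one (norm_val_of_unitary huΛb).le).trans (add_le_add hθΛb ?_)
    rw [Units.val_mul]
    exact (B8Ineq170.norm_mul_sub_one_le_of_norm_le_one (norm_val_of_unitary ((unitaryUnits _).mul_mem huA₁ huA₂)).le).trans (add_le_add hθA₁A₂ hθΛμ)
  have stepC : ‖((B * Λν * (A₁ * A₂) * Λμ : (Matrix n n ℂ)ˣ) : Matrix n n ℂ)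
      - ((B * (Λa * Λb) * (A₁ * A₂ * Λμ) * g ^ ((q μ).toNat * L) : (Matrix n n ℂ)ˣ) : Matrix n n ℂ)‖
      ≤ 2 * (((L - 1 : ℕ) * L) * a₀) * (θL + (θ + θL)) := by
    rw [hΛν, show (B * (Λa * g ^ ((q μ).toNat * L) * Λb) * (A₁ * A₂) * Λμ : (Matrix n n ℂ)ˣ)
        = (B * Λa) * (g ^ ((q μ).toNat * L) * (Λb * (A₁ * A₂ * Λμ))) * 1 by group,
      show (B * (Λa * Λb) * (A₁ * A₂ * Λμ) * g ^ ((q μ).toNat * L) : (Matrix n n ℂ)ˣ)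
        = (B * Λa) * ((Λb * (A₁ * A₂ * Λμ)) * g ^ ((q μ).toNat * L)) * 1 by group]
    refine (norm_val_swap_le ((unitaryUnits _).mul_mem (huA _ _ _) huΛa) (unitaryUnits _).one_mem _ _).trans ?_
    exact two_mul_mul_le (mul_le_mul hgkL hΛbAΛ (norm_nonneg _) (by positivity))
  -- STEP D (root version): the exponent tally leaves one root `g`, which is then COMMUTED past the frame `Z`
  have hmν : (q ν).toNat = L - 1 := by have := (hq ν).1; omega
  have hmμ : (q μ).toNat = L - 1 := by have := (hq μ).1; omega
  obtain ⟨Z, hZdef⟩ : ∃ Z : (Matrix n n ℂ)ˣ, Z = B * (Λa * Λb) * (A₁ * A₂ * Λμ) * g ^ ((L - 1) * L) := ⟨_, rfl⟩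
  have huZ : Z ∈ unitaryUnits (Matrix n n ℂ) := by
    rw [hZdef]
    exact (unitaryUnits _).mul_mem ((unitaryUnits _).mul_mem ((unitaryUnits _).mul_mem (huA _ _ _)
      ((unitaryUnits _).mul_mem huΛa huΛb)) ((unitaryUnits _).mul_mem ((unitaryUnits _).mul_mem huA₁ huA₂)
      (huL _ _ _))) (hugk _)
  have hd1 : (1 : ℝ) ≤ d := by
    have : 1 ≤ d := by have := ν.isLt; omega
    exact_mod_cast this
  have hgLL : ‖((g ^ ((L - 1) * L) : (Matrix n n ℂ)ˣ) : Matrix n n ℂ) - 1‖ ≤ θL := by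
    refine (norm_val_pow_sub_one_le hgu _).trans ?_
    rw [hθLdef]; push_cast
    have h0 : (0 : ℝ) ≤ ((L - 1 : ℕ) : ℝ) * L * a₀ := by positivity
    have h1 := mul_le_mul_of_nonneg_right hd1 h0
    have h2 : (((L - 1 : ℕ) : ℝ) * (L : ℝ)) * ‖((g : (Matrix n n ℂ)ˣ) : Matrix n n ℂ) - 1‖ ≤ ((L - 1 : ℕ) : ℝ) * L * a₀ :=
      mul_le_mul_of_nonneg_left (ha _ _ _ hμν) (by positivity)
    linarith [h1, h2]
  have hθZ : ‖(Z : Matrix n n ℂ) - 1‖ ≤ 2 * θ + 3 * θL := by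
    rw [hZdef, Units.val_mul]
    refine (B8Ineq170.norm_mul_sub_one_le_of_norm_le_one ?_).trans ?_
    · rw [← norm_val_of_unitary ((unitaryUnits _).mul_mem ((unitaryUnits _).mul_mem (huA _ _ _)
        ((unitaryUnits _).mul_mem huΛa huΛb)) ((unitaryUnits _).mul_mem ((unitaryUnits _).mul_mem huA₁ huA₂) (huL _ _ _)))]
    have h3 : ‖((B * (Λa * Λb) * (A₁ * A₂ * Λμ) : (Matrix n n ℂ)ˣ) : Matrix n n ℂ) - 1‖ ≤ θ + θL + (θ + θL) := by
      rw [Units.val_mul]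
      refine (B8Ineq170.norm_mul_sub_one_le_of_norm_le_one ?_).trans (add_le_add hBΛab ?_)
      · exact (norm_val_of_unitary ((unitaryUnits _).mul_mem (huA _ _ _) ((unitaryUnits _).mul_mem huΛa huΛb))).le
      · rw [Units.val_mul]
        exact (B8Ineq170.norm_mul_sub_one_le_of_norm_le_one (norm_val_of_unitary ((unitaryUnits _).mul_mem huA₁ huA₂)).le).trans (add_le_add hθA₁A₂ hθΛμ)
    linarith [add_le_add h3 hgLL]
  have eXZ : (B * (Λa * Λb) * (A₁ * A₂ * Λμ) * ((g ^ (q ν).toNat)⁻¹ * g ^ (L * L)) : (Matrix n n ℂ)ˣ) = Z * g := by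
    rw [hmν, pow_corner_tally g hL, hZdef]; group
  have eYZ : (B * (Λa * Λb) * (A₁ * A₂ * Λμ) * g ^ ((q μ).toNat * L) : (Matrix n n ℂ)ˣ) = Z := by
    rw [hmμ, hZdef]
  have hga : ‖(g : Matrix n n ℂ) - 1‖ ≤ a₀ := ha _ _ _ hμν
  have hZg : ‖(Z : Matrix n n ℂ) - 1‖ * ‖(g : Matrix n n ℂ) - 1‖ ≤ (2 * θ + 3 * θL) * a₀ :=
    mul_le_mul hθZ hga (norm_nonneg _) (by linarith [hθ0, hθL0])
  have stepD : ‖((Z * g : (Matrix n n ℂ)ˣ) : Matrix n n ℂ) - ((g * Z : (Matrix n n ℂ)ˣ) : Matrix n n ℂ)‖ ≤ 2 * (2 * θ + 3 * θL) * a₀ := by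
    have h1 := norm_comm_le (Z : Matrix n n ℂ) (g : Matrix n n ℂ)
    have h2 := two_mul_mul_le hZg
    rw [Units.val_mul, Units.val_mul]
    exact h1.trans h2
  -- the `g·Y` side, with the left frame `g` stripped
  have stepC' : ‖((g * Z : (Matrix n n ℂ)ˣ) : Matrix n n ℂ)
      - ((g * (B * Λν * (A₁ * A₂) * Λμ) : (Matrix n n ℂ)ˣ) : Matrix n n ℂ)‖
      ≤ 2 * (((L - 1 : ℕ) * L) * a₀) * (θL + (θ + θL)) := by
    rw [norm_val_mul_left_sub hgu, norm_sub_rev, ← eYZ]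
    exact stepC
  have stepA2' : ‖((g * (B * Λν * (A₁ * A₂) * Λμ) : (Matrix n n ℂ)ˣ) : Matrix n n ℂ)
      - ((g * (B * Λν * (At₁ * At₂) * (tν * Λh * tν⁻¹)) : (Matrix n n ℂ)ˣ) : Matrix n n ℂ)‖
      ≤ d * ((L - 1 : ℕ) * δ) + d * (((L - 1 : ℕ) * L) * δ) := by
    rw [norm_val_mul_left_sub hgu, norm_sub_rev]
    exact stepA2
  -- assemble: X → X' → X'' → X''' = Z g ; g Y → g Y' → g Y'' = g Z ; |Z g − g Z| ≤ 2‖Z − 1‖ a₀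
  have tri : ∀ (a b c : Matrix n n ℂ), ‖a - c‖ ≤ ‖a - b‖ + ‖b - c‖ := fun a b c => norm_sub_le_norm_sub_add_norm_sub a b c
  calc ‖((A * Λμ * (tμ * Bs * tμ⁻¹) * (tμ * Λs * tμ⁻¹) * g ^ (L * L) : (Matrix n n ℂ)ˣ) : Matrix n n ℂ)
        - ((g * (B * Λν * (tν * As * tν⁻¹) * (tν * Λh * tν⁻¹)) : (Matrix n n ℂ)ˣ) : Matrix n n ℂ)‖
      ≤ (d * ((L - 1 : ℕ) * δ) + d * (((L - 1 : ℕ) * L) * δ))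
        + ((2 * (θ + θL) * (θ + θL) + (2 * ((L - 1 : ℕ) * a₀) * (θ + θL)
          + (2 * (2 * θ + 3 * θL) * a₀ + (2 * (((L - 1 : ℕ) * L) * a₀) * (θL + (θ + θL))
            + (d * ((L - 1 : ℕ) * δ) + d * (((L - 1 : ℕ) * L) * δ))))))) := by
        rw [hAt]
        refine (tri _ _ _).trans (add_le_add stepA1 ?_)
        refine (tri _ _ _).trans (add_le_add stepB1 ?_)
        refine (tri _ _ _).trans (add_le_add stepB2 ?_)
        rw [eXZ]
        refine (tri _ _ _).trans (add_le_add stepD ?_)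
        exact (tri _ _ _).trans (add_le_add stepC' stepA2')
    _ = _ := by rw [hθdef, hθLdef]; ring

end CaseIV

end

end Summit.QuantumFields.BalabanUV.T4Continuum.SkeletonFillFullRootCorner
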